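import Mathlib
import HarnessLib
import Summits.NavierStokesRegularity.NavierStokesRegularity.Theorems.HalfSpaceWindowDoorCirculationCarryingRigidityRecordLiouville

/-!
# Route `HalfSpaceWindowDoor`, crux `CirculationCarryingRigidity` (stmt-NavierStokesRegularity-25311) —
# line `cone_sweep`, the RESIDUE of `HemisphereLiouvilleE3`: the RADIAL LIFT `∮ ω_r v₃ dl` on record far circles

LEAD ns-hsw-p1 g9, `--supports stmt-NavierStokesRegularity-25311 --as helper`; card `Cruxes/…/Lines/cone_sweep.md`.  In the circle term
`−T = ∮_{S(r,z)}(ω_r v₃ − v_r ω₃) dl` the part `−v_r ω₃` is harmless in the Type-I class (`−v_rω₃ ≤ (C/√(−s))ω₃`, `neg_circleTerm_le_radialLift`),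
so the transport bound of `…RecordLiouville` (p688291) follows from a bound on the RADIAL LIFT alone:
`∮_{S(r,z)} ω_r v₃ dl ≤ (B/√(−t)) ∮_{S(r,z)} ω₃ dl` on the record far circles about one axis of one far-past epoch ⇒ POLOIDAL
(`inner_curl_e3_eq_zero_of_radialLiftBound`); the open stub reduces BY NAME to that bound (`hemisphereLiouvilleE3_of_radialLiftBound`), and a
circulation-carrying closed-hemisphere profile has, in every far-past epoch, record far circles where rising fluid carries inward-pointing vortex
lines (or sinking fluid outward-pointing ones) with `√(−t)·∮ω_r v₃ dl / ∮ω₃ dl` as large as we please (`enemy_radialLift_fails`).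
WHAT THIS IS NOT: not about NS regularity; HYPOTHETICAL profiles; `HemisphereLiouvilleE3` itself stays OPEN.  No item is closed by this file.
-/

noncomputable section

-- the summit and its single sub-problem share the name (CONVENTIONS §1), as in every Theorems file
set_option linter.dupNamespace false

namespace Summit.NavierStokesRegularity.NavierStokesRegularity.Theorems.HalfSpaceWindowDoorCirculationCarryingRigidityRadialLift

open MeasureTheory Set Function Filter Topology InnerProductSpace
open scoped RealInnerProductSpace InnerProductSpace
open Literature.Analysis Literature.Analysis.UnboundedOperators
open Literature.Analysis.FluidPDE hiding eR
open Summit.NavierStokesRegularity.NavierStokesRegularity.Theses.HalfSpaceWindowDoor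
open Summit.NavierStokesRegularity.NavierStokesRegularity.Theorems.HalfSpaceWindowDoorCirculationCarryingRigidityDefs
  (InDoorClass SignE3 e3 HemisphereLiouvilleE3)
open Summit.NavierStokesRegularity.NavierStokesRegularity.Theorems.AxisTwistDoorAveragedConeLiouvilleDefs
  (cylPt eT eR circ vortCirc circleTerm)
open Summit.NavierStokesRegularity.NavierStokesRegularity.Theorems.AveragedConeLiouville.CircleStokes (continuous_eR)
open Summit.NavierStokesRegularity.NavierStokesRegularity.Theorems.AxisTwistDoorAveragedConeLiouvilleCylFrame
  (continuous_cylPt_θ abs_inner_eR_le)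
open Summit.NavierStokesRegularity.NavierStokesRegularity.Theorems.HalfSpaceWindowDoorCirculationCarryingRigidityConeFluxSubsolution
  (signE3_atd contDiff_one_slice)
open Summit.NavierStokesRegularity.NavierStokesRegularity.Theorems.HalfSpaceWindowDoorCirculationCarryingRigidityRecordLiouville
  (inner_curl_e3_eq_zero_of_recordTransportBound)

variable {C : ℝ} {v : ℝ → EuclideanSpace ℝ (Fin 3) → EuclideanSpace ℝ (Fin 3)}

/-- **The circle term against the radial lift.**  In the Type-I class, `−T(r,z,s) ≤ (C/√(−s))∮_{S(r,z)}ω₃ dl + ∮_{S(r,z)} ω_r v₃ dl`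
(`−v_rω₃ ≤ |v|ω₃ ≤ (C/√(−s))ω₃` pointwise, `ω₃ ≥ 0`). -/
theorem neg_circleTerm_le_radialLift (hv : InDoorClass C v) (hsign : SignE3 v) {s : ℝ} (hs : s < 0) {r : ℝ} (hr : 0 ≤ r)
    (z : ℝ) :
    -circleTerm v r z s ≤ C / Real.sqrt (-s) * vortCirc v r z s +
      ∫ θ in (0 : ℝ)..(2 * Real.pi), ⟪curl (v s) (cylPt r θ z), eR θ⟫ *
        ⟪v s (cylPt r θ z), Summit.NavierStokesRegularity.NavierStokesRegularity.Theorems.AxisTwistDoorAveragedConeLiouvilleDefs.e3⟫ * r := by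
  have hv1 := contDiff_one_slice hv hs
  have hvc : Continuous fun θ => v s (cylPt r θ z) := hv1.continuous.comp (continuous_cylPt_θ r z)
  have hωc : Continuous fun θ => curl (v s) (cylPt r θ z) := by
    have hD : Continuous (fderiv ℝ (v s)) := hv1.continuous_fderiv one_ne_zero
    have e : curl (v s) = fun x => curlCLM (fderiv ℝ (v s) x) := by funext x; exact curl_eq_curlCLM (v s) x
    rw [e]
    exact (curlCLM.continuous.comp hD).comp (continuous_cylPt_θ r z)
  have hc1 : Continuous fun θ => (⟪v s (cylPt r θ z), eR θ⟫ *
      ⟪curl (v s) (cylPt r θ z), Summit.NavierStokesRegularity.NavierStokesRegularity.Theorems.AxisTwistDoorAveragedConeLiouvilleDefs.e3⟫ -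
      ⟪curl (v s) (cylPt r θ z), eR θ⟫ *
      ⟪v s (cylPt r θ z), Summit.NavierStokesRegularity.NavierStokesRegularity.Theorems.AxisTwistDoorAveragedConeLiouvilleDefs.e3⟫) * r :=
    (((hvc.inner continuous_eR).mul (hωc.inner continuous_const)).sub ((hωc.inner continuous_eR).mul (hvc.inner continuous_const))).mul
      continuous_const
  have hc2 : Continuous fun θ =>
      ⟪curl (v s) (cylPt r θ z), Summit.NavierStokesRegularity.NavierStokesRegularity.Theorems.AxisTwistDoorAveragedConeLiouvilleDefs.e3⟫ * r :=
    (hωc.inner continuous_const).mul continuous_const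
  have hc3 : Continuous fun θ => ⟪curl (v s) (cylPt r θ z), eR θ⟫ *
      ⟪v s (cylPt r θ z), Summit.NavierStokesRegularity.NavierStokesRegularity.Theorems.AxisTwistDoorAveragedConeLiouvilleDefs.e3⟫ * r :=
    (((hωc.inner continuous_eR).mul (hvc.inner continuous_const))).mul continuous_const
  unfold circleTerm vortCirc
  rw [← intervalIntegral.integral_neg, ← intervalIntegral.integral_const_mul,
    ← intervalIntegral.integral_add ((hc2.const_mul _).intervalIntegrable _ _) (hc3.intervalIntegrable _ _)]
  refine intervalIntegral.integral_mono_on (by positivity) (hc1.neg.intervalIntegrable _ _)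
    (((hc2.const_mul _).add hc3).intervalIntegrable _ _) fun θ _ => ?_
  have hsq : 0 < Real.sqrt (-s) := Real.sqrt_pos.2 (neg_pos.2 hs)
  have hvr : |⟪v s (cylPt r θ z), eR θ⟫| ≤ C / Real.sqrt (-s) := (abs_inner_eR_le _ θ).trans (hv.1 s hs _)
  have hω3 : 0 ≤ ⟪curl (v s) (cylPt r θ z),
      Summit.NavierStokesRegularity.NavierStokesRegularity.Theorems.AxisTwistDoorAveragedConeLiouvilleDefs.e3⟫ := signE3_atd hsign s hs _
  have h1 := (abs_le.1 hvr).1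
  have key : -⟪v s (cylPt r θ z), eR θ⟫ * (⟪curl (v s) (cylPt r θ z),
      Summit.NavierStokesRegularity.NavierStokesRegularity.Theorems.AxisTwistDoorAveragedConeLiouvilleDefs.e3⟫ * r) ≤
      C / Real.sqrt (-s) * (⟪curl (v s) (cylPt r θ z),
      Summit.NavierStokesRegularity.NavierStokesRegularity.Theorems.AxisTwistDoorAveragedConeLiouvilleDefs.e3⟫ * r) :=
    mul_le_mul_of_nonneg_right (by linarith) (mul_nonneg hω3 hr)
  linarith [key]

/-- **`HemisphereLiouvilleE3` FROM A RADIAL-LIFT BOUND ON RECORD FAR CIRCLES OF ONE FAR-PAST EPOCH.**  Door class (any `C`) + `⟪curl v, e₃⟫ ≥ 0`;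
fix `B, R₀ ≥ 0`, `R₁ = 4(B + C) + R₀ + 1` and an epoch `σ₀ < 0`; if on every record far circle (`r ≥ R₀√(−t)`, `Γ(r,z,t) > Γ(R₁√(−s'),z',s')` for all
`s' ≤ t`, `z'`) at every time `t ≤ σ₀` the radial lift obeys `∮_{S(r,z)} ω_r v₃ dl ≤ (B/√(−t)) ∮_{S(r,z)} ω₃ dl`, then `⟪curl v, e₃⟫ ≡ 0`. -/
theorem inner_curl_e3_eq_zero_of_radialLiftBound (hv : InDoorClass C v) (hsign : SignE3 v) {B : ℝ} (hB : 0 ≤ B)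
    {R₀ : ℝ} (hR₀ : 0 ≤ R₀) {σ₀ : ℝ} (hσ₀ : σ₀ < 0)
    (hlift : ∀ t : ℝ, t ≤ σ₀ → ∀ r : ℝ, R₀ * Real.sqrt (-t) ≤ r → ∀ z : ℝ,
      (∀ s' : ℝ, s' ≤ t → ∀ z' : ℝ, circ v ((4 * (B + C) + R₀ + 1) * Real.sqrt (-s')) z' s' < circ v r z t) →
      (∫ θ in (0 : ℝ)..(2 * Real.pi), ⟪curl (v t) (cylPt r θ z), eR θ⟫ *
        ⟪v t (cylPt r θ z), Summit.NavierStokesRegularity.NavierStokesRegularity.Theorems.AxisTwistDoorAveragedConeLiouvilleDefs.e3⟫ * r) ≤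
        B / Real.sqrt (-t) * vortCirc v r z t) :
    ∀ s < 0, ∀ y, ⟪curl (v s) y, e3⟫ = 0 := by
  have hC : 0 ≤ C := HalfSpaceWindowDoorCirculationCarryingRigidityConeFluxSubsolution.typeI_const_nonneg hv
  refine inner_curl_e3_eq_zero_of_recordTransportBound hv hsign (B := B + C) (by positivity) hR₀ hσ₀ fun t ht r hr z hrec => ?_
  have ht0 : t < 0 := lt_of_le_of_lt ht hσ₀
  have hr0 : 0 ≤ r := le_trans (by positivity) hr
  have h1 := neg_circleTerm_le_radialLift hv hsign ht0 hr0 z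
  have h2 := hlift t ht r hr z hrec
  rw [add_div, add_mul]
  linarith

/-- **CENSUS READING (enemy form).**  A circulation-carrying closed-hemisphere door-class profile has, in EVERY far-past epoch `(−∞, σ₀]` and for
all `B, R₀ ≥ 0`, a RECORD far circle at a time `t ≤ σ₀` on which the radial lift beats the vertical vorticity:
`∮_{S(r,z)} ω_r v₃ dl > (B/√(−t)) ∮_{S(r,z)} ω₃ dl`. -/
theorem enemy_radialLift_fails (hv : InDoorClass C v) (hsign : SignE3 v) (hpos : ∃ σ < 0, ∃ y, 0 < ⟪curl (v σ) y, e3⟫)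
    {B : ℝ} (hB : 0 ≤ B) {R₀ : ℝ} (hR₀ : 0 ≤ R₀) {σ₀ : ℝ} (hσ₀ : σ₀ < 0) :
    ∃ t : ℝ, t ≤ σ₀ ∧ ∃ r : ℝ, R₀ * Real.sqrt (-t) ≤ r ∧ ∃ z : ℝ,
      (∀ s' : ℝ, s' ≤ t → ∀ z' : ℝ, circ v ((4 * (B + C) + R₀ + 1) * Real.sqrt (-s')) z' s' < circ v r z t) ∧
      B / Real.sqrt (-t) * vortCirc v r z t <
        ∫ θ in (0 : ℝ)..(2 * Real.pi), ⟪curl (v t) (cylPt r θ z), eR θ⟫ *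
          ⟪v t (cylPt r θ z), Summit.NavierStokesRegularity.NavierStokesRegularity.Theorems.AxisTwistDoorAveragedConeLiouvilleDefs.e3⟫ * r := by
  by_contra h
  push Not at h
  obtain ⟨σ, hσ, y, hy⟩ := hpos
  have h0 := inner_curl_e3_eq_zero_of_radialLiftBound hv hsign hB hR₀ hσ₀ (fun t ht r hr z hrec => h t ht r hr z hrec) σ hσ y
  exact hy.ne' h0

/-- **BY-NAME REDUCTION of the open stub to the radial-lift bound.** -/
theorem hemisphereLiouvilleE3_of_radialLiftBound
    (H : ∀ (C : ℝ) (v : ℝ → EuclideanSpace ℝ (Fin 3) → EuclideanSpace ℝ (Fin 3)), InDoorClass C v → SignE3 v →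
      ∃ B : ℝ, 0 ≤ B ∧ ∃ R₀ : ℝ, 0 ≤ R₀ ∧ ∃ σ₀ : ℝ, σ₀ < 0 ∧
        ∀ t : ℝ, t ≤ σ₀ → ∀ r : ℝ, R₀ * Real.sqrt (-t) ≤ r → ∀ z : ℝ,
          (∀ s' : ℝ, s' ≤ t → ∀ z' : ℝ, circ v ((4 * (B + C) + R₀ + 1) * Real.sqrt (-s')) z' s' < circ v r z t) →
          (∫ θ in (0 : ℝ)..(2 * Real.pi), ⟪curl (v t) (cylPt r θ z), eR θ⟫ *
            ⟪v t (cylPt r θ z), Summit.NavierStokesRegularity.NavierStokesRegularity.Theorems.AxisTwistDoorAveragedConeLiouvilleDefs.e3⟫ * r) ≤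
            B / Real.sqrt (-t) * vortCirc v r z t) :
    HemisphereLiouvilleE3 := by
  intro C v hrate hcont hmild hdiv hnn
  have hv : InDoorClass C v := ⟨hrate, hcont, hmild, hdiv⟩
  obtain ⟨B, hB, R₀, hR₀, σ₀, hσ₀, hlift⟩ := H C v hv hnn
  exact inner_curl_e3_eq_zero_of_radialLiftBound hv hnn hB hR₀ hσ₀ hlift

/-! ### Appended (LEAD ns-hsw-p1 g9): the pointwise stratum «no inward vortex lines where the fluid rises» is poloidal -/

/-- **STRATUM KILLED: far-field anti-correlation of radial vorticity and vertical velocity.**  If, in some far-past epoch `t ≤ σ₀` and on every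
far circle `S(r,z)` about the axis (`r ≥ R₀√(−t)`), the radial vorticity and the vertical velocity are pointwise ANTI-correlated,
`ω_r v₃ ≤ 0` (vortex lines point OUTWARD wherever the fluid rises and inward wherever it sinks), then the closed-hemisphere door-class profile is
poloidal — the radial lift is `≤ 0` and `inner_curl_e3_eq_zero_of_radialLiftBound` applies with `B = 0`. -/
theorem inner_curl_e3_eq_zero_of_radialLift_nonpos (hv : InDoorClass C v) (hsign : SignE3 v) {R₀ : ℝ} (hR₀ : 0 ≤ R₀)
    {σ₀ : ℝ} (hσ₀ : σ₀ < 0)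
    (hneg : ∀ t : ℝ, t ≤ σ₀ → ∀ r : ℝ, R₀ * Real.sqrt (-t) ≤ r → ∀ z θ : ℝ,
      ⟪curl (v t) (cylPt r θ z), eR θ⟫ *
        ⟪v t (cylPt r θ z), Summit.NavierStokesRegularity.NavierStokesRegularity.Theorems.AxisTwistDoorAveragedConeLiouvilleDefs.e3⟫ ≤ 0) :
    ∀ s < 0, ∀ y, ⟪curl (v s) y, e3⟫ = 0 := by
  refine inner_curl_e3_eq_zero_of_radialLiftBound hv hsign le_rfl hR₀ hσ₀ fun t ht r hr z _ => ?_
  have ht0 : t < 0 := lt_of_le_of_lt ht hσ₀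
  have hr0 : 0 ≤ r := le_trans (by positivity) hr
  have hv1 := contDiff_one_slice hv ht0
  have hvc : Continuous fun θ => v t (cylPt r θ z) := hv1.continuous.comp (continuous_cylPt_θ r z)
  have hωc : Continuous fun θ => curl (v t) (cylPt r θ z) := by
    have hD : Continuous (fderiv ℝ (v t)) := hv1.continuous_fderiv one_ne_zero
    have e : curl (v t) = fun x => curlCLM (fderiv ℝ (v t) x) := by funext x; exact curl_eq_curlCLM (v t) x
    rw [e]
    exact (curlCLM.continuous.comp hD).comp (continuous_cylPt_θ r z)
  have hc3 : Continuous fun θ => ⟪curl (v t) (cylPt r θ z), eR θ⟫ *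
      ⟪v t (cylPt r θ z), Summit.NavierStokesRegularity.NavierStokesRegularity.Theorems.AxisTwistDoorAveragedConeLiouvilleDefs.e3⟫ * r :=
    (((hωc.inner continuous_eR).mul (hvc.inner continuous_const))).mul continuous_const
  have hle : (∫ θ in (0 : ℝ)..(2 * Real.pi), ⟪curl (v t) (cylPt r θ z), eR θ⟫ *
      ⟪v t (cylPt r θ z), Summit.NavierStokesRegularity.NavierStokesRegularity.Theorems.AxisTwistDoorAveragedConeLiouvilleDefs.e3⟫ * r) ≤
      ∫ _ in (0 : ℝ)..(2 * Real.pi), (0 : ℝ) :=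
    intervalIntegral.integral_mono_on (by positivity) (hc3.intervalIntegrable _ _) intervalIntegrable_const fun θ _ =>
      mul_nonpos_of_nonpos_of_nonneg (hneg t ht r hr z θ) hr0
  rw [intervalIntegral.integral_const, smul_zero] at hle
  have h0 : (0 : ℝ) / Real.sqrt (-t) * vortCirc v r z t = 0 := by rw [zero_div, zero_mul]
  rw [h0]
  exact hle

/-! ### Appended (LEAD ns-hsw-p1 g9): the POINTWISE radial-lift stratum -/

/-- **STRATUM KILLED: pointwise radial lift dominated by vertical vorticity in the far field.**  If, in some far-past epoch `t ≤ σ₀` and on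
every far circle about the axis (`r ≥ R₀√(−t)`), pointwise `ω_r v₃ ≤ (K/√(−t)) ω₃` (any `K ≥ 0`) — this contains every cone stratum
(`|ω_r| ≤ K'ω₃` with `|v₃| ≤ C/√(−t)`), the anti-correlated stratum `ω_r v₃ ≤ 0`, and lets `ω_r v₃` be arbitrarily negative — then the
closed-hemisphere door-class profile is poloidal. -/
theorem inner_curl_e3_eq_zero_of_pointwise_radialLift (hv : InDoorClass C v) (hsign : SignE3 v) {K : ℝ} (hK : 0 ≤ K) {R₀ : ℝ}
    (hR₀ : 0 ≤ R₀) {σ₀ : ℝ} (hσ₀ : σ₀ < 0)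
    (hpt : ∀ t : ℝ, t ≤ σ₀ → ∀ r : ℝ, R₀ * Real.sqrt (-t) ≤ r → ∀ z θ : ℝ,
      ⟪curl (v t) (cylPt r θ z), eR θ⟫ *
        ⟪v t (cylPt r θ z), Summit.NavierStokesRegularity.NavierStokesRegularity.Theorems.AxisTwistDoorAveragedConeLiouvilleDefs.e3⟫ ≤
        K / Real.sqrt (-t) *
          ⟪curl (v t) (cylPt r θ z), Summit.NavierStokesRegularity.NavierStokesRegularity.Theorems.AxisTwistDoorAveragedConeLiouvilleDefs.e3⟫) :
    ∀ s < 0, ∀ y, ⟪curl (v s) y, e3⟫ = 0 := by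
  refine inner_curl_e3_eq_zero_of_radialLiftBound hv hsign hK hR₀ hσ₀ fun t ht r hr z _ => ?_
  have ht0 : t < 0 := lt_of_le_of_lt ht hσ₀
  have hr0 : 0 ≤ r := le_trans (by positivity) hr
  have hv1 := contDiff_one_slice hv ht0
  have hvc : Continuous fun θ => v t (cylPt r θ z) := hv1.continuous.comp (continuous_cylPt_θ r z)
  have hωc : Continuous fun θ => curl (v t) (cylPt r θ z) := by
    have hD : Continuous (fderiv ℝ (v t)) := hv1.continuous_fderiv one_ne_zero
    have e : curl (v t) = fun x => curlCLM (fderiv ℝ (v t) x) := by funext x; exact curl_eq_curlCLM (v t) x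
    rw [e]
    exact (curlCLM.continuous.comp hD).comp (continuous_cylPt_θ r z)
  have hc3 : Continuous fun θ => ⟪curl (v t) (cylPt r θ z), eR θ⟫ *
      ⟪v t (cylPt r θ z), Summit.NavierStokesRegularity.NavierStokesRegularity.Theorems.AxisTwistDoorAveragedConeLiouvilleDefs.e3⟫ * r :=
    (((hωc.inner continuous_eR).mul (hvc.inner continuous_const))).mul continuous_const
  have hc2 : Continuous fun θ =>
      ⟪curl (v t) (cylPt r θ z), Summit.NavierStokesRegularity.NavierStokesRegularity.Theorems.AxisTwistDoorAveragedConeLiouvilleDefs.e3⟫ * r :=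
    (hωc.inner continuous_const).mul continuous_const
  unfold vortCirc
  rw [← intervalIntegral.integral_const_mul]
  refine intervalIntegral.integral_mono_on (by positivity) (hc3.intervalIntegrable _ _) ((hc2.const_mul _).intervalIntegrable _ _)
    fun θ _ => ?_
  have h := mul_le_mul_of_nonneg_right (hpt t ht r hr z θ) hr0
  linarith [h]

end Summit.NavierStokesRegularity.NavierStokesRegularity.Theorems.HalfSpaceWindowDoorCirculationCarryingRigidityRadialLift

end
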